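import Literature.Geometry.Symplectic.SteinDomain
import Literature.Topology.FourManifolds.Gluing
import Literature.Topology.FourManifolds.SmoothOrientation
import Literature.Topology.FourManifolds.Handles
import Literature.Topology.FourManifolds.HandlebodySplitting
import Mathlib.Topology.Homotopy.Equiv
import HarnessLib

/-!
# Akbulut–Matveyev: every closed oriented smooth 4-manifold is a union of two Stein domains

Named fact (D-0014) requested by route SmoothPoincare4/SymplecticCap, crux 2 (`wi-03918`):
S. Akbulut, R. Matveyev, *A convex decomposition theorem for 4-manifolds*, IMRN 1998, no. 7,
371–381 (arXiv:math/0010166). The paper's Theorem 3 is stated CONDITIONALLY — given a decomposition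
`X = X₁ ∪_∂ X₂` of the closed oriented smooth 4-manifold `X` into two compact codimension-0 pieces
each built from 0-, 1- and 2-handles only, both pieces can be made (after handle trading /
isotopy) into compact Stein domains ("PC manifolds": a strictly plurisubharmonic Morse function
whose maximum level set is the boundary) — and the unconditional statement of the abstract /
introduction follows by taking `X₁ =` the 0-, 1-, 2-handles of a handle decomposition and `X₂ =`
the dual 0-, 1-handles (the 3-, 4-handles turned upside down): **every closed oriented smooth
4-manifold is `X = W₁ ∪_∂ W₂` with `W₁` and `W̄₂` compact Stein domains.**

Rendering with tree vocabulary (review of p3146):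

* the two pieces are ABSTRACT compact `C^∞` 4-manifolds with boundary (`𝓡∂ 4`) and the
  decomposition is the tree's closed gluing `Literature.IsClosedGluing (𝓡∂ 4) (𝓡∂ 4) (𝓡 4) (P := X) R`
  (`Gluing.lean`: smooth embeddings `Manifold.IsSmoothEmbedding` of both pieces covering `X` and
  meeting exactly along `R`), with the gluing relation `R` relating ONLY boundary points of `W₁` to
  boundary points of `W₂` (`IsBoundaryRelation`; so interiors are disjoint and the pieces meet
  along `∂W₁ ≅ ∂W₂`);
* Stein pieces via `Literature.Geometry.Symplectic.IsSteinDomain` (`SteinDomain.lean`; a PC manifold in AM's sense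
  gives a `SteinStructure`: `J` integrable, `φ` strictly `J`-convex, `∂W` the regular maximal level
  set — regularity of the maximum level by the E. Hopf boundary point lemma for strictly
  plurisubharmonic functions, as in Eliashberg's characterisation of Stein domains);
* orientability via the trunk-wide `Literature.IsOrientable (𝓡 4) X` (`SmoothOrientation.lean`).
  Orientation bookkeeping (`W̄₂`) is invisible since `IsSteinDomain W₂` only asserts that the
  abstract manifold `W₂` admits SOME Stein structure; AM do not assume connectedness (our extra
  `ConnectedSpace X` is harmless). Hence the recorded fact is implied by the paper.

## Decomposition of the fact (the fact is XL)

A sorry-free proof of `akbulut_matveyev` needs a whole theory absent from Mathlib and the tree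
(Eliashberg's Legendrian-surgery characterisation of Stein handlebodies, Legendrian realisation
and Thurston–Bennequin numbers in `#k S¹ × S²`, the paper's Whitehead-multiple / positron
defect-reduction moves of §§2–3).  The printed architecture is "abstract ⇐ Theorem 3 + a handle
decomposition", and its second half is **proved**:

* `Literature.Geometry.Symplectic.akbulut_matveyev_of_thm3` — **proved**: the statement of the
  paper's Theorem 3 (the explicit hypothesis `h3`; see the next section) and Milnor's final
  rearrangement theorem (the tree's named fact
  `Literature.Topology.FourManifolds.exists_isSelfIndexing_criticalSet_eq 4`,
  `NiceMorseFunctions.lean`; Milnor 1965, Thm. 4.8) imply `akbulut_matveyev`.  The topological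
  input "every closed smooth 4-manifold is a closed gluing `X = X₁ ∪_∂ X₂` of a compact
  2-handlebody `X₁` (its `0`-, `1`-, `2`-handles) and a compact 1-handlebody `X₂` (its `3`-,
  `4`-handles turned upside down) along a boundary relation" — the decomposition with which the
  paper, §4 (proof of Cor. 1: "Consider arbitrary handle decomposition of `X` …") and
  Gompf–Stipsicz (1999), §4.4 work — is the PROVED theorem
  `Literature.Topology.FourManifolds.exists_twoHandlebody_closedGluing_of_rearrangement`
  (`Literature/Topology/FourManifolds/HandlebodySplitting.lean`: cut the closed manifold at the
  regular level `5/2` of a self-indexing Morse function; Milnor 1965, Lemma 2.9), conditional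
  only on that rearrangement fact; a 1-handlebody is a 2-handlebody
  (`IsHandlebodyOfIndexLE.mono`), and the homotopy equivalences are forgotten.

## Theorem 3 as printed: merged back into the fact (review D-0026, 2026-08-15)

The first half — the paper's Theorem 3 **as printed** (conditional form; §4 of
arXiv:math/0010166 = IMRN 1998, no. 7, 371–381): *"Let `X = X₁ ∪_∂ X₂` be a decomposition of
a closed smooth oriented 4-manifold into a union of two compact, smooth, codimension zero
submanifolds `X₁` and `X₂` along common boundary.  Suppose each `Xᵢ`, `i = 1, 2`, has a
handlebody without 3- and 4-handles.  Then there exist another decomposition `X = X̃₁ ∪_∂ X̃₂`,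
such that manifolds `X̃₁` and `-X̃₂` admit structures of PC manifolds and each `X̃ᵢ` is
homotopy equivalent to `Xᵢ`, `i = 1, 2`"* — was formerly recorded in this file as a second
named fact, `AkbulutMatveyev1998_thm3`, the
decomposition child of `akbulut_matveyev` under the earlier protocol for XL facts, together
with the one-line projection `AkbulutMatveyev1998_thm3.exists_isSteinDomain` (Theorem 3 with
the homotopy equivalences dropped).  Its rendering survives verbatim, type-checked, as the
hypothesis `h3` of `akbulut_matveyev_of_thm3`: the given decomposition is a closed gluing of two
compact `C^∞` 4-manifolds with boundary along a boundary relation (`IsClosedGluing`,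
`IsBoundaryRelation`), "has a handlebody without 3- and 4-handles" is
`Literature.Topology.FourManifolds.IsHandlebodyOfIndexLE 3 2` (Morse-theoretic form: an adapted
Morse function with critical points of index `≤ 2`; Milnor 1963, Thm. 3.2), PC pieces are
`IsSteinDomain`, and homotopy equivalence is Mathlib's `ContinuousMap.HomotopyEquiv`.

Its proving seat triaged the child XL, so it came up for review under the fact-decomposition
discipline (D-0026: decomposition children are distinct, M-sized published results, and
decompositions do not recurse).  Findings, with the source open (arXiv:math/0010166: abstract;
§1 ¶1, PC manifolds; Thm. 2 and the defect, §3; Thm. 3 with its proof and Cor. 1, §4):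

* **In the source, faithfully rendered, not open.**  Hypotheses imply print's: "closed smooth
  oriented" is compact Hausdorff second-countable boundaryless `C^∞` with `IsOrientable` (an
  orientation is a free choice; print does not assume connectedness either); a closed gluing
  along a boundary relation is print's "`X₁ ∪_∂ X₂` along common boundary" (interiors are
  disjoint by `IsBoundaryRelation`, and every boundary point of either piece is glued, by
  invariance of domain, `X` having no boundary); the Morse-theoretic `IsHandlebodyOfIndexLE 3 2`
  is print's "has a handlebody without 3- and 4-handles" (handles from critical points and
  back: Milnor 1963, §3; Kosinski 1993, VII, Thm. 1.1 and §2).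
  Conclusions are print's or weaker: a PC manifold (compact complex, with a strictly
  plurisubharmonic Morse `ψ` whose set of maxima is `∂X`, §1 ¶1) carries a `SteinStructure`
  (`J` integrable, `ψ` strictly `J`-convex, `∂X` the maximal level set — regular, since at a
  critical point lying on a level hypersurface of maxima the Hessian would vanish on the
  3-dimensional tangent space of `∂X` and be degenerate, contradicting Morse); and
  `IsSteinDomain X̃₂` forgets the orientation reversal in `-X̃₂`.  The theorem is published
  with its proof (IMRN 1998) and uncontested: nothing to restate, not an open problem.
* **But mis-cut as a decomposition child, hence merged back.**  Theorem 3 is the paper's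
  principal theorem and `akbulut_matveyev` (the abstract) is its immediate corollary — the few
  proved lines of `akbulut_matveyev_of_thm3` over `HandlebodySplitting.lean` — so the child
  carried the whole of the parent's difficulty.  It is XL: the printed proof runs through
  Eliashberg's theorem (Thm. 2 = E1 + E2 below), `C⁰`-small Legendrian realisation of the
  attaching circles, the Whitehead multiples `Pₙ(K, f)` and positrons `Wₙ` of §2 (with
  `tb(Pₙ(K, tb K)) - tb K = n - 1`, "`Wₙ` … has PC structure if `n ≥ 2`"), the defect
  reduction `Z ↦ Z' = Z ♮ W_k` of §3, its realisation
  `X'₁ = [X₁ ∖ Nd_{X₁}(PₙD)] ∪ Nd_{X₂}(P_kF)` inside `X` with the homotopy-equivalence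
  bookkeeping of §4, and a second pass on `-X = (-X̄₂) ∪ (-X̄₁)`.  The distinct published
  results below it with locators of their own are already the named facts E1, E2, ST, ISO,
  MULTI of the list that follows (E2 itself reviewed and kept as irreducibly XL,
  `SteinTwoHandles.lean`); what lies between them and Theorem 3 is the paper's own argument of
  §§2–4 — a
  slice of the proof with no separate locator, not admissible as further children — and no
  declaration consumed the child except its glue.  As a named fact it therefore only re-counted
  the debt of `akbulut_matveyev` (its seat could do nothing but wait for the same leaves), and
  it has been **merged back** into the proof obligation of `akbulut_matveyev`: the `def` is
  deleted, the proved reduction keeps its name with Theorem 3 spelled out as the explicit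
  hypothesis `h3` (a hypothesis, not a claim on that obligation), and the unused projection
  goes with the `def`.  The Legendrian realisation of links (LR; Gompf 1998, §1), merged
  earlier into the child's obligation (`LegendrianRealisation.lean`, module docstring), is now
  likewise part of the obligation of `akbulut_matveyev`, and the references to
  `AkbulutMatveyev1998_thm3` in the module docstrings of the sibling files name that
  obligation.  A future proof of `akbulut_matveyev` proves Theorem 3 as an inline `theorem` with
  the statement of `h3` and feeds it to `akbulut_matveyev_of_thm3`.

Below the fact lie (state of the decomposition DAG, refreshed 2026-08-15 (fourth pass); see
also the sibling files):

* **Handles.** "`Xᵢ` has a handlebody without 3- and 4-handles" (`IsHandlebodyOfIndexLE 3 2 Xᵢ`,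
  Morse-theoretic) ⟹ `Xᵢ = Yᵢ ∪ 2-handles` with `Yᵢ` a compact 1-handlebody and the 2-handles
  attached simultaneously along attaching maps `h̄ : T → Yᵢ` (Kosinski VI §6): the named fact
  `Literature.Topology.FourManifolds.IsHandlebodyOfIndexLE.exists_isMultiAttachment`
  (`Topology/FourManifolds/HandlePresentations.lean`, Kosinski VII Cor. 1.2) over the vocabulary
  `HandleAttachingMap 3 2 W`, `HandleAttachingMap.IsMultiAttachment`, `attachingCircle`,
  `attachingFraming` of `Topology/FourManifolds/HandleAttachingMaps.lean` (2-handles attached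
  *along prescribed framed knots*);
* **Eliashberg's theorem, part I** (1-handlebodies are Stein; Thm. 2 (1) of the paper, Gompf
  1998, Thm. 1.3): the named fact `Gompf1998_thm13_noTwoHandles` (`SteinHandlebodies.lean`); its
  base case, the standard PC structure on `B⁴`, is **proved**: `steinStructureClosedBall`,
  `isSteinDomain_closedBall` (`SteinBall.lean`; conventions checked in `SteinBallContact.lean`),
  whence the conclusion of `akbulut_matveyev` for `X = S⁴ = B⁴ ∪_{S³} B⁴` is a theorem
  (`akbulut_matveyev_sphere`, `AkbulutMatveyevSphere.lean`);
* **the Stein layer is honest**: `J` is a continuous bundle map and `d^ℂφ`, `ω = -dd^ℂφ` are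
  smooth forms (`SteinJBundle.lean`, `SteinLiouville.lean`), **a Stein domain is a Liouville
  domain** for `λ = -d^ℂφ` (`SteinStructure.isLiouvilleDomain`, the "from Stein to Weinstein"
  bridge of `SteinDomain.lean`), and **a Stein domain is orientable** by its complex orientation
  (`SteinStructure.complexOrientation : SmoothOrientation (𝓡∂ 4) W`, `SteinStructure.isOrientable`,
  `SteinOrientation.lean`, over the linear algebra of `ComplexStructureOrientation.lean`:
  a real automorphism commuting with `J` has positive determinant);
* **Stabilisation of Legendrian knots in `∂W`** (§3): the named fact `Gompf1998_addLeftTwists`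
  (`LegendrianRealisation.lean`, with the defect-zero normalisation of §3 proved from it; the
  **Legendrian `C⁰`-small realisation of links** of §4, first paragraph — Gompf 1998, §1 —
  formerly the named fact `Gompf1998_legendrianRealisation` of that file, faithful but XL and
  consumed by no declaration, was merged back into the proof obligation of Theorem 3, i.e. now
  of `akbulut_matveyev` itself: review D-0026, 2026-08-15, recorded in that file's module
  docstring together with its former rendering), over the contact vocabulary of
  `SteinBoundaryContact.lean`
  (`contactPlane`, `IsLegendrianKnot`, `IsKnotFraming`, `SteinStructure.twisting`,
  `SteinStructure.defect`), whose sign conventions are **proved** right on the model: the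
  standard Legendrian unknot `K₀ ⊆ ∂B⁴` is a Legendrian knot whose Seifert framing has twisting
  `+1`, i.e. `tb(K₀) = -1` (`SteinBallLegendrian.lean`); **the twisting number is a homotopy
  invariant of the framing** (TH, Gompf §1 "up to fiber homotopy") is a **theorem**:
  `twisting_eq_of_framingHomotopic_holds` (`TwistingHomotopyProofs.lean`: joint continuity of
  the twisting loops of a framing family, free-homotopy invariance of the winding number);
* **the attached manifold only depends on the framed isotopy class of the attaching circles,
  and every framed knot is an attaching circle** (the tacit topological steps when attaching
  circles are replaced by Legendrian / stabilised isotopic copies): the named fact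
  `HandleAttachingMap.isMultiAttachment_of_linkIsotopyInBoundary` (ISO; reviewed under D-0026 and
  found provable inline along the roadmap in the module docstring of `TwoHandleIsotopy.lean`)
  and the **discharged** fact `exists_handleAttachingMap_of_isKnotFraming` (TUBE, `W` orientable —
  automatic for Stein `W`; `exists_handleAttachingMap_of_isKnotFraming_holds`,
  `TwoHandleIsotopyProofs.lean`), `TwoHandleIsotopy.lean`;
* **Eliashberg's theorem, part II** (2-handles along Legendrian knots with framing `tb - 1`,
  Thm. 2 (2) = Gompf Thm. 1.3 (b)–(c)): the named fact `Gompf1998_thm13_twoHandles` (E2,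
  `SteinTwoHandles.lean`); **the defect-zero criterion of §3** (D: "So if the defect is zero, the
  PC structure extends over 2-handles") is **proved from E2, ST and ISO** — the paper's
  two-sentence derivation (stabilise until `tb = f + 1`, then apply Eliashberg) replayed in
  `DefectZeroProofs.lean` / `DefectZeroOfEliashberg.lean`
  (`AkbulutMatveyev1998_defectZero_of_E2_ST_ISO`; `AkbulutMatveyev1998_defectZero_iff_thm13_twoHandles`:
  D ⟺ E2 under ST, ISO), all its tacit inputs being theorems — TUBE (above), "handle framings
  are knot framings" (`isKnotFraming_attachingFraming`, `AttachingFramingProofs.lean`),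
  "attaching circles are knots in `∂W`" (`isBoundaryKnot_attachingCircle`,
  `AttachingCircleProofs.lean`), TH and the orientability of Stein domains (above).  D was
  formerly a second named fact `AkbulutMatveyev1998_defectZero` of `SteinTwoHandles.lean`; being
  E2's corollary rather than a distinct result, it was merged back into E2 (review D-0026,
  2026-08-15, recorded with its former rendering in the module docstrings of
  `SteinTwoHandles.lean` and `DefectZeroOfEliashberg.lean`).  The whole pipeline is **proved** to
  compute what it should on the model: the untwisted 2-handle on `B⁴` along `K₀` has handle framing = Seifert
  framing, twisting `+1`, defect `2` (outside E2: it gives `S² × D²`), the doubly left-twisted one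
  has twisting `-1`, defect `0` (inside E2: the `-2`-framed unknot, `T*S²`), `SteinBallHandle.lean`,
  `SteinBallHandleTwisted.lean`;
* **boundary connected sum of PC manifolds is PC** (§3 `Z' = Z ♮ W_k`, §5 `Ñ = N'' ♮ (-A''₁)`;
  Eliashberg's 1-handles): now **statable** — the *oriented* boundary connected sum
  `IsOrientedBoundaryConnectedSum` (`Topology/FourManifolds/OrientedBoundaryConnectedSum.lean`)
  taken with the complex orientations `SteinStructure.complexOrientation` of the two Stein
  structures; the statement (BC: such a sum `(P, oP)` of compact Stein `X`, `Y` is a Stein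
  domain) is drafted in the proving unit's folder and is to enter the tree only through the
  fact-split path (D-0026), not as a side effect of this fact;
* **not yet statable**: the Whitehead-multiple / positron lemmas of §2 (band sums and
  satellites in `∂W`; the tree's `BandSum.lean` is for knots in `S³`) and the defect-reduction /
  realisation-inside-`X` constructions of §§3–4 ("removing a tubular neighbourhood of a proper
  disc", complements in `X`, and the *relative* form of BC keeping the PC structure on `Z ⊂ Z'`).

## References

* S. Akbulut, R. Matveyev, *A convex decomposition theorem for 4-manifolds*, Internat. Math. Res.
  Notices 1998, no. 7, 371–381; arXiv:math/0010166, abstract and Thm. 3 [AkbulutMatveyev1998].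
* R. E. Gompf, *Handlebody construction of Stein surfaces*, Ann. of Math. 148 (1998) [Gompf1998].
* Ya. Eliashberg, *Topological characterization of Stein manifolds of dimension > 2*, Internat.
  J. Math. 1 (1990), 29–46 [Eliashberg1990Stein].
* J. Milnor, *Lectures on the h-cobordism theorem*, Princeton (1965), Lemma 2.9 (p. 11 of the
  held copy), Thm. 4.8 and Def. 4.9 (p. 25) [MilnorHCobordism1965].
* A. A. Kosinski, *Differential Manifolds* (1993), VI §6 (attaching handles), VII Cor. 1.2
  (handle presentations). [Kosinski1993]
-/

noncomputable section

open scoped Manifold ContDiff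
open Set

namespace Literature.Geometry.Symplectic

/-- A gluing relation between two 4-manifolds with boundary is a **boundary relation** if it only
relates boundary points to boundary points (so that in a closed gluing along it the interiors of
the two pieces are disjoint and the pieces meet along their boundaries). [Akbulut–Matveyev 1998,
§1 (`X = X₁ ∪_∂ X₂`); Bröcker–Jänich 1982, §13] [folklore] -/
def IsBoundaryRelation (W₁ W₂ : Type*) [TopologicalSpace W₁] [ChartedSpace (EuclideanHalfSpace 4) W₁]
    [TopologicalSpace W₂] [ChartedSpace (EuclideanHalfSpace 4) W₂] (R : W₁ → W₂ → Prop) : Prop :=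
  ∀ w₁ w₂, R w₁ w₂ → (𝓡∂ 4).IsBoundaryPoint w₁ ∧ (𝓡∂ 4).IsBoundaryPoint w₂

/-- **Akbulut–Matveyev (1998): convex decomposition of closed oriented 4-manifolds** (IMRN 1998,
abstract; Thm. 3 there applied to `X₁ =` 0-,1-,2-handles, `X₂ =` dual 0-,1-handles). Every closed
(compact, Hausdorff, second countable, boundaryless `C^∞` atlas on `ℝ⁴`), connected, orientable
smooth 4-manifold `X` is a closed gluing `X = W₁ ∪_∂ W₂` of two compact `C^∞` 4-manifolds with
boundary, each admitting a Stein structure, along a relation between their boundaries.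
[cite: AkbulutMatveyev1998, abstract and Thm. 3] -/
def akbulut_matveyev : Prop :=
  ∀ (X : Type) [TopologicalSpace X] [T2Space X] [SecondCountableTopology X] [CompactSpace X]
    [ConnectedSpace X] [ChartedSpace (EuclideanSpace ℝ (Fin 4)) X] [IsManifold (𝓡 4) ∞ X],
    Literature.Topology.FourManifolds.IsOrientable (𝓡 4) X →
    ∃ (W₁ W₂ : Type) (_ : TopologicalSpace W₁) (_ : ChartedSpace (EuclideanHalfSpace 4) W₁)
      (_ : IsManifold (𝓡∂ 4) ∞ W₁) (_ : CompactSpace W₁)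
      (_ : TopologicalSpace W₂) (_ : ChartedSpace (EuclideanHalfSpace 4) W₂)
      (_ : IsManifold (𝓡∂ 4) ∞ W₂) (_ : CompactSpace W₂) (R : W₁ → W₂ → Prop),
      IsSteinDomain W₁ ∧ IsSteinDomain W₂ ∧ IsBoundaryRelation W₁ W₂ R ∧
        Literature.Topology.FourManifolds.IsClosedGluing (𝓡∂ 4) (𝓡∂ 4) (𝓡 4) (P := X) R

/-! ### API -/

/-- The swapped relation of a boundary relation is a boundary relation. [folklore] -/
theorem IsBoundaryRelation.swap {W₁ W₂ : Type*} [TopologicalSpace W₁]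
    [ChartedSpace (EuclideanHalfSpace 4) W₁] [TopologicalSpace W₂]
    [ChartedSpace (EuclideanHalfSpace 4) W₂] {R : W₁ → W₂ → Prop} (h : IsBoundaryRelation W₁ W₂ R) :
    IsBoundaryRelation W₂ W₁ (Function.swap R) :=
  fun w₂ w₁ hR => (h w₁ w₂ hR).symm

/-- In a closed gluing along a boundary relation, interior points of the first piece are not in the
image of the second. [folklore] -/
theorem IsBoundaryRelation.not_mem_range {X W₁ W₂ : Type*} [TopologicalSpace X]
    [TopologicalSpace W₁] [ChartedSpace (EuclideanHalfSpace 4) W₁] [TopologicalSpace W₂]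
    [ChartedSpace (EuclideanHalfSpace 4) W₂] {R : W₁ → W₂ → Prop} (hR : IsBoundaryRelation W₁ W₂ R)
    {j₁ : W₁ → X} {j₂ : W₂ → X} (hj : ∀ a b, j₁ a = j₂ b ↔ R a b) {w : W₁}
    (hw : (𝓡∂ 4).IsInteriorPoint w) : j₁ w ∉ range j₂ := by
  rintro ⟨w₂, hw₂⟩
  have hb := (hR w w₂ ((hj w w₂).1 hw₂.symm)).1
  exact ((𝓡∂ 4).isInteriorPoint_iff_not_isBoundaryPoint w).1 hw hb

/-- Symmetrically, interior points of the second piece are not in the image of the first.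
[folklore] -/
theorem IsBoundaryRelation.not_mem_range_left {X W₁ W₂ : Type*} [TopologicalSpace X]
    [TopologicalSpace W₁] [ChartedSpace (EuclideanHalfSpace 4) W₁] [TopologicalSpace W₂]
    [ChartedSpace (EuclideanHalfSpace 4) W₂] {R : W₁ → W₂ → Prop} (hR : IsBoundaryRelation W₁ W₂ R)
    {j₁ : W₁ → X} {j₂ : W₂ → X} (hj : ∀ a b, j₁ a = j₂ b ↔ R a b) {w : W₂}
    (hw : (𝓡∂ 4).IsInteriorPoint w) : j₂ w ∉ range j₁ :=
  hR.swap.not_mem_range (fun b a => by rw [eq_comm]; exact hj a b) hw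

/-- Under the fact, a closed connected orientable smooth 4-manifold is a closed gluing of two
compact pieces (projection for consumers of `Gluing.lean`). [folklore] -/
theorem akbulut_matveyev.exists_gluing (h : akbulut_matveyev) (X : Type) [TopologicalSpace X]
    [T2Space X] [SecondCountableTopology X] [CompactSpace X] [ConnectedSpace X]
    [ChartedSpace (EuclideanSpace ℝ (Fin 4)) X] [IsManifold (𝓡 4) ∞ X] (ho : Literature.Topology.FourManifolds.IsOrientable (𝓡 4) X) :
    ∃ (W₁ W₂ : Type) (_ : TopologicalSpace W₁) (_ : ChartedSpace (EuclideanHalfSpace 4) W₁)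
      (_ : TopologicalSpace W₂) (_ : ChartedSpace (EuclideanHalfSpace 4) W₂) (R : W₁ → W₂ → Prop),
      Literature.Topology.FourManifolds.IsClosedGluing (𝓡∂ 4) (𝓡∂ 4) (𝓡 4) (P := X) R := by
  obtain ⟨W₁, W₂, _, _, _, _, _, _, _, _, R, -, -, -, hg⟩ := h X ho
  exact ⟨W₁, W₂, _, _, _, _, R, hg⟩

/-! ### The assembly: the abstract from Theorem 3 (as a hypothesis) and Milnor's rearrangement -/

/-- **Assembly (proved): the abstract of Akbulut–Matveyev (1998) from its Theorem 3 and
Milnor's final rearrangement theorem.**  The hypothesis `h3` is the paper's Theorem 3 as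
printed — *"Let `X = X₁ ∪_∂ X₂` be a decomposition of a closed smooth oriented 4-manifold into a
union of two compact, smooth, codimension zero submanifolds `X₁` and `X₂` along common
boundary.  Suppose each `Xᵢ`, `i = 1, 2`, has a handlebody without 3- and 4-handles.  Then
there exist another decomposition `X = X̃₁ ∪_∂ X̃₂`, such that manifolds `X̃₁` and `-X̃₂` admit
structures of PC manifolds and each `X̃ᵢ` is homotopy equivalent to `Xᵢ`, `i = 1, 2`"* (PC
manifold = compact complex manifold with a strictly plurisubharmonic Morse function whose set
of maximum points is the boundary, §1 of the paper; rendered by `IsSteinDomain`, the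
orientation reversal on `X̃₂` being invisible for the abstract manifold `X̃₂`) — in the
rendering audited in the module docstring: the decomposition is a closed gluing of two compact
`C^∞` 4-manifolds with boundary along a boundary relation (`IsClosedGluing`,
`IsBoundaryRelation`), "has a handlebody without 3- and 4-handles" is
`Literature.Topology.FourManifolds.IsHandlebodyOfIndexLE 3 2` (Morse-theoretic form, Milnor
1963, Thm. 3.2), and homotopy equivalence is Mathlib's `ContinuousMap.HomotopyEquiv`.  (This
statement was formerly the named fact `AkbulutMatveyev1998_thm3`, merged back into the proof
obligation of `akbulut_matveyev` under review D-0026, see the module docstring; here it is a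
hypothesis, to be fed the inline theorem once Theorem 3 is proved.)  By
`Literature.Topology.FourManifolds.exists_twoHandlebody_closedGluing_of_rearrangement`
(`HandlebodySplitting.lean`, proved from the named fact
`Literature.Topology.FourManifolds.exists_isSelfIndexing_criticalSet_eq 4` = Milnor 1965,
Thm. 4.8, and Lemma 2.9: cut at the regular level `5/2` of a self-indexing Morse function) the
closed 4-manifold is a closed gluing `X = X₁ ∪_∂ X₂` of its `0`-, `1`-, `2`-handles (a compact
2-handlebody) and its `3`-, `4`-handles (a compact 1-handlebody upside down, in particular a
2-handlebody, `IsHandlebodyOfIndexLE.mono`) along a relation between boundary points; apply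
Theorem 3 to it and forget the homotopy equivalences.  This is the deduction
"abstract ⇐ Thm. 3" of the paper (§4, proof of Cor. 1, first sentence, for the general handle
decomposition). [cite: AkbulutMatveyev1998, abstract and Thm. 3] -/
theorem akbulut_matveyev_of_thm3
    (h3 : ∀ (X : Type) [TopologicalSpace X] [T2Space X] [SecondCountableTopology X]
      [CompactSpace X] [ChartedSpace (EuclideanSpace ℝ (Fin 4)) X] [IsManifold (𝓡 4) ∞ X],
      Literature.Topology.FourManifolds.IsOrientable (𝓡 4) X →
      ∀ (X₁ X₂ : Type) [TopologicalSpace X₁] [ChartedSpace (EuclideanHalfSpace 4) X₁]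
        [IsManifold (𝓡∂ 4) ∞ X₁] [CompactSpace X₁] [TopologicalSpace X₂]
        [ChartedSpace (EuclideanHalfSpace 4) X₂] [IsManifold (𝓡∂ 4) ∞ X₂] [CompactSpace X₂]
        (R : X₁ → X₂ → Prop),
        Literature.Topology.FourManifolds.IsHandlebodyOfIndexLE 3 2 X₁ →
        Literature.Topology.FourManifolds.IsHandlebodyOfIndexLE 3 2 X₂ →
        IsBoundaryRelation X₁ X₂ R →
        Literature.Topology.FourManifolds.IsClosedGluing (𝓡∂ 4) (𝓡∂ 4) (𝓡 4) (P := X) R →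
        ∃ (W₁ W₂ : Type) (_ : TopologicalSpace W₁) (_ : ChartedSpace (EuclideanHalfSpace 4) W₁)
          (_ : IsManifold (𝓡∂ 4) ∞ W₁) (_ : CompactSpace W₁)
          (_ : TopologicalSpace W₂) (_ : ChartedSpace (EuclideanHalfSpace 4) W₂)
          (_ : IsManifold (𝓡∂ 4) ∞ W₂) (_ : CompactSpace W₂) (R' : W₁ → W₂ → Prop),
          IsSteinDomain W₁ ∧ IsSteinDomain W₂ ∧ IsBoundaryRelation W₁ W₂ R' ∧
            Literature.Topology.FourManifolds.IsClosedGluing (𝓡∂ 4) (𝓡∂ 4) (𝓡 4) (P := X) R' ∧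
            Nonempty (ContinuousMap.HomotopyEquiv W₁ X₁) ∧
            Nonempty (ContinuousMap.HomotopyEquiv W₂ X₂))
    (hR : Literature.Topology.FourManifolds.exists_isSelfIndexing_criticalSet_eq.{0} 4) :
    akbulut_matveyev := by
  intro X _ _ _ _ _ _ _ ho
  obtain ⟨X₁, X₂, _, _, _, _, _, _, _, _, _, _, _, _, R, h₁, h₂, hR', hg⟩ :=
    Literature.Topology.FourManifolds.exists_twoHandlebody_closedGluing_of_rearrangement hR X
  obtain ⟨W₁, W₂, _, _, _, _, _, _, _, _, R', hs₁, hs₂, hR'', hg', -, -⟩ :=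
    h3 X ho X₁ X₂ R h₁ (h₂.mono one_le_two) hR' hg
  exact ⟨W₁, W₂, _, _, _, _, _, _, _, _, R', hs₁, hs₂, hR'', hg'⟩

end Literature.Geometry.Symplectic

end
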